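import Summits.HodgeConjecture.HodgeConjecture.Theses.SevenfoldWeilCensus
import Literature.AlgebraicGeometry.Motives.AbelianVarietyPoincareCompleteReducibility
import Literature.AlgebraicGeometry.Motives.AbelianVarietyIsogenyProofs

/-!
# Birth skeleton (BC3) for crux `SevenfoldWeilCensus.CodimTwoFromLowerDim` (stmt-HodgeConjecture-18721)

X2 (codimension-2 census on complex abelian 6- and 7-folds): every rational `(2,2)`-class lies in
`D² ⊔ span{g^* w : C abelian, dim C < dim A, w rational (2,2) on C}`.

Skeleton = the simple / non-simple case tree foreseen in the route's TWO-LAYER PLAN, with the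
non-simple case routed through Poincaré complete reducibility (a THEOREM of the tree,
`AbelianVariety.poincare_hP1`), `dim_prod` and `dim_eq_of_isIsogeny` inside the composition:

* `stub_simpleSeven` — simple SEVENFOLDS: `B² = D²` (Tankeev 1982 / Ribet 1983: for a simple complex
  abelian variety of PRIME dimension the Hodge group is `Sp_D(V, φ)` and `B• = D•`;
  van Geemen 1994 Thm. 4.6, Moonen–Zarhin 1999 Thm. (2.x) p. 6). A literature-grade piece: to be
  discharged by name once the Tankeev–Ribet fact is filed in `Literature/`.
* `stub_simpleSix` — simple SIXFOLDS: the Mumford–Tate / Hodge-group census of simple abelian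
  sixfolds in codimension 2 (types I–IV; for simple `A` every morphism to a lower-dimensional abelian
  variety is constant, so this says `B²(A) ⊗ ℂ ⊆ D² ⊗ ℂ ⊔ (pull-backs)`, i.e. essentially `B² = D²`
  for every simple sixfold — the HARDEST stub; risk: degenerate CM types, type IV with an imaginary
  quadratic field of multiplicities (1,5)/(2,4) (Moonen–Zarhin 1998), small Hodge groups).
* `stub_productCensus` — PRODUCTS `Y × Z` (`0 < dim Y`, `0 < dim Z`, `dim Y + dim Z ∈ {6, 7}`):
  the Künneth / product lemmas one dimension past Moonen–Zarhin 1999 §3 (Hazama, Murty): mixed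
  Künneth Hodge classes in `H¹⊗H³`, `H²⊗H²`, `H³⊗H¹` come from divisors and lower-dimensional
  pull-backs.
* `stub_isogenyDescent` — the target property descends along an isogeny `g : B → A`
  (van Geemen 1994, 3.6–3.7: `g^*` is an isomorphism of rational Hodge structures; quasi-inverse
  isogeny `g' : A → B`, `g ∘ g' = [n]`, `[n]^* = n⁴` on `H⁴`; pull-back preserves `D²` and composes
  the pull-back span).

`CodimTwoFromLowerDim_of` is the kernel-checked composition (no sorry): case `A` simple — by
dimension, Tankeev (into `D²`, `Submodule.mem_sup_left`) or the sixfold census; case `A` not simple —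
an abelian subvariety `i : Y ↪ A` with `0 < dim Y < dim A` exists by definition of `IsSimple`,
Poincaré reducibility gives `j : Z ↪ A` with `(i, j) : Y ⊞ Z → A` an isogeny, hence an isogeny
`Y × Z → A` (`biprodIsoProd`), `dim (Y × Z) = dim A` (`dim_eq_of_isIsogeny`), `0 < dim Z`
(`dim_prod`), then the product census and isogeny descent. Its hypotheses are the four statements
under the name-keyed aliases `__Registered.stub_*` (the native skeleton audit keys hypotheses by the
registered stub names). `sorry` occurs ONLY inside the four `stub_*` theorems; `#print axioms
CodimTwoFromLowerDim_of` = `propext, Classical.choice, Quot.sound`.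

No stub alone gives the crux or the summit: `SimpleSeven` / `SimpleSix` cover one dimension each and
only SIMPLE varieties (and `SimpleSeven` lands in `D²`); `ProductCensus` speaks only of products with
two positive-dimensional factors (silent on simple `A`; that a non-simple `A` is isogenous to such a
product is Poincaré reducibility, used in the composition, not in the stub); `IsogenyDescent` needs
the census on an isogenous `B`. BC3 probes (registrar folder `bc/probe*.lean`, each restating the
stub statement as a hypothesis and importing only the route file + Literature — a probe must NOT
import this file, else `exact?` closes the crux through `CodimTwoFromLowerDim_of` and the sorried
stubs): `stub → CodimTwoFromLowerDim` and `stub → HodgeConjecture` by `exact?` / `simpa [·]` /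
`(unfold ·; simpa)` / `aesop` all FAIL (8/8; for `ProductCensus` the default-transparency `exact?`
diverges in `whnf` on failing defeq problems through `IsOfHodgeType` / singular cohomology — no proof
at 4·10⁶ heartbeats — and answers "could not close the goal" once those constants are made locally
irreducible). Disproof used: none — no `Disproof.lean` is filed on this crux (`ledger crux ls
stmt-HodgeConjecture-18721`, 2026-08-17). Negatives index (`ledger negatives --problem
HodgeConjecture`, 3 entries: Milnor-K exponential symbol lift, derived-Torelli Fermat K3 exhaustion,
E-line transport matrix) — disjoint from all four stubs.
-/

set_option linter.dupNamespace false

namespace Summit.HodgeConjecture.HodgeConjecture.Cruxes.CodimTwoFromLowerDim.Birth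

open CategoryTheory CategoryTheory.Limits

/-! ## The four statements (named, so that the skeleton theorem's hypotheses are keyed by the
registered stub names — cf. `Cruxes/HodgeAbelianDimGeEight/Lines/birth.lean`) -/

/-- **Statement of stub 1 — simple sevenfolds (Tankeev 1982 / Ribet 1983; van Geemen 1994 Thm. 4.6;
Moonen–Zarhin 1999 p. 6).** On a SIMPLE complex abelian variety of (prime) dimension `7` every rational
`(2,2)`-class is a `ℂ`-combination of divisor monomials, `B² ⊗ ℂ = D² ⊗ ℂ`. -/
def SimpleSeven : Prop :=
    ∀ A : Literature.AlgebraicGeometry.Motives.AbelianVariety ℂ, A.dim = 7 →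
      Literature.AlgebraicGeometry.Motives.AbelianVariety.IsSimple A →
      ∀ c : Literature.AlgebraicGeometry.HodgeTheory.complexBetti A.X (2 * 2),
        Literature.AlgebraicGeometry.HodgeTheory.IsRationalClass c →
        Literature.AlgebraicGeometry.HodgeTheory.IsOfHodgeType A.dim A.X (2 * 2) 2 2 c →
        c ∈ Literature.Barriers.HodgeConjecture.divisorClassesSpan A.X A.dim 2

/-- **Statement of stub 2 — simple sixfolds (the codimension-2 Hodge-group census of SIMPLE abelian
sixfolds, Albert types I–IV; Moonen–Zarhin 1995/1998/1999 one dimension up).** On a simple complex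
abelian sixfold every rational `(2,2)`-class lies in `D² ⊗ ℂ ⊔ span` of pull-backs of rational
`(2,2)`-classes from abelian varieties of smaller dimension. -/
def SimpleSix : Prop :=
    ∀ A : Literature.AlgebraicGeometry.Motives.AbelianVariety ℂ, A.dim = 6 →
      Literature.AlgebraicGeometry.Motives.AbelianVariety.IsSimple A →
      ∀ c : Literature.AlgebraicGeometry.HodgeTheory.complexBetti A.X (2 * 2),
        Literature.AlgebraicGeometry.HodgeTheory.IsRationalClass c →
        Literature.AlgebraicGeometry.HodgeTheory.IsOfHodgeType A.dim A.X (2 * 2) 2 2 c →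
        c ∈ Literature.Barriers.HodgeConjecture.divisorClassesSpan A.X A.dim 2 ⊔
          Submodule.span ℂ {w' : Literature.AlgebraicGeometry.HodgeTheory.complexBetti A.X (2 * 2) |
            ∃ (C : Literature.AlgebraicGeometry.Motives.AbelianVariety ℂ) (g : A.X ⟶ C.X)
              (w : Literature.AlgebraicGeometry.HodgeTheory.complexBetti C.X (2 * 2)),
              C.dim < A.dim ∧ Literature.AlgebraicGeometry.HodgeTheory.IsRationalClass w ∧
                Literature.AlgebraicGeometry.HodgeTheory.IsOfHodgeType C.dim C.X (2 * 2) 2 2 w ∧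
                w' = Literature.AlgebraicGeometry.HodgeTheory.complexBetti.map g (2 * 2) w}

/-- **Statement of stub 3 — products (product lemmas one dimension past Moonen–Zarhin 1999 §3;
Hazama 1989, Murty 1984).** On a PRODUCT `Y × Z` of complex abelian varieties of positive dimensions
with `dim Y + dim Z ∈ {6, 7}` every rational `(2,2)`-class lies in `D² ⊗ ℂ ⊔ span` of pull-backs of
rational `(2,2)`-classes from abelian varieties of smaller dimension (the two projections included). -/
def ProductCensus : Prop :=
    ∀ Y Z : Literature.AlgebraicGeometry.Motives.AbelianVariety ℂ, 0 < Y.dim → 0 < Z.dim →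
      ((Y.prod Z).dim = 6 ∨ (Y.prod Z).dim = 7) →
      ∀ c : Literature.AlgebraicGeometry.HodgeTheory.complexBetti (Y.prod Z).X (2 * 2),
        Literature.AlgebraicGeometry.HodgeTheory.IsRationalClass c →
        Literature.AlgebraicGeometry.HodgeTheory.IsOfHodgeType (Y.prod Z).dim (Y.prod Z).X (2 * 2) 2 2 c →
        c ∈ Literature.Barriers.HodgeConjecture.divisorClassesSpan (Y.prod Z).X (Y.prod Z).dim 2 ⊔
          Submodule.span ℂ {w' : Literature.AlgebraicGeometry.HodgeTheory.complexBetti (Y.prod Z).X (2 * 2) |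
            ∃ (C : Literature.AlgebraicGeometry.Motives.AbelianVariety ℂ) (g : (Y.prod Z).X ⟶ C.X)
              (w : Literature.AlgebraicGeometry.HodgeTheory.complexBetti C.X (2 * 2)),
              C.dim < (Y.prod Z).dim ∧ Literature.AlgebraicGeometry.HodgeTheory.IsRationalClass w ∧
                Literature.AlgebraicGeometry.HodgeTheory.IsOfHodgeType C.dim C.X (2 * 2) 2 2 w ∧
                w' = Literature.AlgebraicGeometry.HodgeTheory.complexBetti.map g (2 * 2) w}

/-- **Statement of stub 4 — isogeny descent (van Geemen 1994, 3.6–3.7).** If `g : B → A` is an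
isogeny of complex abelian varieties and every rational `(2,2)`-class on `B` lies in `D²(B) ⊗ ℂ ⊔`
(pull-backs from smaller dimension), then the same holds on `A` (quasi-inverse isogeny `g'` with
`g ∘ g' = [n]_A`, `[n]^* = n⁴` on `H⁴`, functoriality of divisor monomials and of the pull-back span,
`dim B = dim A`). -/
def IsogenyDescent : Prop :=
    ∀ (A B : Literature.AlgebraicGeometry.Motives.AbelianVariety ℂ) (g : B ⟶ A),
      Literature.AlgebraicGeometry.Motives.AbelianVariety.IsIsogeny g →
      (∀ c : Literature.AlgebraicGeometry.HodgeTheory.complexBetti B.X (2 * 2),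
        Literature.AlgebraicGeometry.HodgeTheory.IsRationalClass c →
        Literature.AlgebraicGeometry.HodgeTheory.IsOfHodgeType B.dim B.X (2 * 2) 2 2 c →
        c ∈ Literature.Barriers.HodgeConjecture.divisorClassesSpan B.X B.dim 2 ⊔
          Submodule.span ℂ {w' : Literature.AlgebraicGeometry.HodgeTheory.complexBetti B.X (2 * 2) |
            ∃ (C : Literature.AlgebraicGeometry.Motives.AbelianVariety ℂ) (g : B.X ⟶ C.X)
              (w : Literature.AlgebraicGeometry.HodgeTheory.complexBetti C.X (2 * 2)),
              C.dim < B.dim ∧ Literature.AlgebraicGeometry.HodgeTheory.IsRationalClass w ∧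
                Literature.AlgebraicGeometry.HodgeTheory.IsOfHodgeType C.dim C.X (2 * 2) 2 2 w ∧
                w' = Literature.AlgebraicGeometry.HodgeTheory.complexBetti.map g (2 * 2) w}) →
      ∀ c : Literature.AlgebraicGeometry.HodgeTheory.complexBetti A.X (2 * 2),
        Literature.AlgebraicGeometry.HodgeTheory.IsRationalClass c →
        Literature.AlgebraicGeometry.HodgeTheory.IsOfHodgeType A.dim A.X (2 * 2) 2 2 c →
        c ∈ Literature.Barriers.HodgeConjecture.divisorClassesSpan A.X A.dim 2 ⊔
          Submodule.span ℂ {w' : Literature.AlgebraicGeometry.HodgeTheory.complexBetti A.X (2 * 2) |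
            ∃ (C : Literature.AlgebraicGeometry.Motives.AbelianVariety ℂ) (g : A.X ⟶ C.X)
              (w : Literature.AlgebraicGeometry.HodgeTheory.complexBetti C.X (2 * 2)),
              C.dim < A.dim ∧ Literature.AlgebraicGeometry.HodgeTheory.IsRationalClass w ∧
                Literature.AlgebraicGeometry.HodgeTheory.IsOfHodgeType C.dim C.X (2 * 2) 2 2 w ∧
                w' = Literature.AlgebraicGeometry.HodgeTheory.complexBetti.map g (2 * 2) w}

/-! ## The stubs (the ONLY declarations using `sorry`) -/

/-- stub — simple sevenfolds: `B² ⊗ ℂ = D² ⊗ ℂ` (Tankeev–Ribet, prime dimension). -/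
theorem stub_simpleSeven : SimpleSeven := by
  sorry

/-- stub — simple sixfolds: the codimension-2 census (HARDEST stub). -/
theorem stub_simpleSix : SimpleSix := by
  sorry

/-- stub — products `Y × Z`, `dim Y + dim Z ∈ {6,7}`: Künneth / product lemmas. -/
theorem stub_productCensus : ProductCensus := by
  sorry

/-- stub — isogeny descent of the census property. -/
theorem stub_isogenyDescent : IsogenyDescent := by
  sorry

/-! ## Name-keyed aliases of the four statements — the hypotheses of the skeleton theorem
The native skeleton audit (`ledger skeleton check`) admits a hypothesis of `CodimTwoFromLowerDim_of`
only if its head constant is a registered obligation or is NAMED like a declared stub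
(`skeleton.extra-hypothesis` otherwise); `__Registered.stub_X` is the statement of `stub_X` under the
stub's short name (device of `Cruxes/HodgeAbelianDimGeEight/Lines/birth.lean`). -/
namespace __Registered

/-- Alias of `SimpleSeven` keyed by the registered stub name. -/
abbrev stub_simpleSeven : Prop := SimpleSeven
/-- Alias of `SimpleSix` keyed by the registered stub name. -/
abbrev stub_simpleSix : Prop := SimpleSix
/-- Alias of `ProductCensus` keyed by the registered stub name. -/
abbrev stub_productCensus : Prop := ProductCensus
/-- Alias of `IsogenyDescent` keyed by the registered stub name. -/
abbrev stub_isogenyDescent : Prop := IsogenyDescent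

end __Registered

/-- The kernel-checked composition: the four stubs imply the route crux
`SevenfoldWeilCensus.CodimTwoFromLowerDim` BY NAME (simple / non-simple case tree; Poincaré
complete reducibility, `dim_prod`, `dim_eq_of_isIsogeny` are tree theorems used here). -/
theorem CodimTwoFromLowerDim_of :
    __Registered.stub_simpleSeven → __Registered.stub_simpleSix → __Registered.stub_productCensus →
      __Registered.stub_isogenyDescent →
    Summit.HodgeConjecture.HodgeConjecture.Theses.SevenfoldWeilCensus.CodimTwoFromLowerDim := by
  intro h7 h6 hprod hiso A hA c hc hH
  by_cases hs : Literature.AlgebraicGeometry.Motives.AbelianVariety.IsSimple A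
  · -- simple: by dimension — sixfold census, or Tankeev–Ribet (prime dimension 7) into `D²`
    rcases hA with h | h
    · exact h6 A h hs c hc hH
    · exact Submodule.mem_sup_left (h7 A h hs c hc hH)
  · -- not simple: an abelian subvariety `i : Y ↪ A` with `0 < dim Y < dim A`
    have hex : ∃ (Y : Literature.AlgebraicGeometry.Motives.AbelianVariety ℂ) (i : Y ⟶ A),
        AlgebraicGeometry.IsClosedImmersion
            (Literature.AlgebraicGeometry.Motives.AbelianVariety.Hom.toSchemeHom i) ∧
          0 < Y.dim ∧ Y.dim < A.dim := by
      by_contra hne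
      exact hs fun Y i hi h0 hlt => hne ⟨Y, i, hi, h0, hlt⟩
    obtain ⟨Y, i, hi, hY0, hYA⟩ := hex
    -- Poincaré complete reducibility (tree theorem): `(i, j) : Y ⊞ Z → A` is an isogeny
    obtain ⟨Z, j, -, hσ⟩ :=
      Literature.AlgebraicGeometry.Motives.AbelianVariety.poincare_hP1 ℂ A Y i hi hY0 hYA
    -- hence an isogeny from the product `Y × Z`
    have hσ' : Literature.AlgebraicGeometry.Motives.AbelianVariety.IsIsogeny
        ((Literature.AlgebraicGeometry.Motives.AbelianVariety.biprodIsoProd Y Z).symm.hom ≫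
          biprod.desc i j) :=
      Literature.AlgebraicGeometry.Motives.AbelianVariety.isIsogeny_comp
        (Literature.AlgebraicGeometry.Motives.AbelianVariety.isIsogeny_hom_of_iso
          (Literature.AlgebraicGeometry.Motives.AbelianVariety.biprodIsoProd Y Z).symm) hσ
    -- dimensions: `dim (Y × Z) = dim A ∈ {6, 7}` and `0 < dim Z`
    have hdimP : (Y.prod Z).dim = A.dim :=
      Literature.AlgebraicGeometry.Motives.AbelianVariety.dim_eq_of_isIsogeny hσ'
    have hYZ : (Y.prod Z).dim = Y.dim + Z.dim :=
      Literature.AlgebraicGeometry.Motives.AbelianVariety.dim_prod Y Z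
    have hZ0 : 0 < Z.dim := by omega
    have hPd : (Y.prod Z).dim = 6 ∨ (Y.prod Z).dim = 7 := by omega
    -- product census on `Y × Z`, then isogeny descent to `A`
    exact hiso A (Y.prod Z) _ hσ' (hprod Y Z hY0 hZ0 hPd) c hc hH

end Summit.HodgeConjecture.HodgeConjecture.Cruxes.CodimTwoFromLowerDim.Birth
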